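import Mathlib
import HarnessLib
import HarnessLib.Audit
import Summits.SmoothPoincare4.SmoothPoincare4.Theses.SteinHost
import Literature.Topology.FourManifolds.HandleAttachingMaps
import Literature.Topology.FourManifolds.CorkDecompositionMiddleLevelProofs
import Literature.Topology.FourManifolds.HomotopyS4CompactProofs
import Literature.Geometry.Symplectic.SteinDomain

/-!
# Birth skeleton (BC3), line `birth` — crux `SteinHost.HostStein` (item stmt-SmoothPoincare4-19247, rev 1: embedding form)

Route `route-SmoothPoincare4-SteinHost` ("fake balls in a Stein host"), rank-3 crux
`Summit.SmoothPoincare4.SmoothPoincare4.Theses.SteinHost.HostStein` — THE CRUX, verbatim the route decl: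

> for every smooth homotopy 4-sphere `M` (the bare binders of `SmoothPoincare4`: Hausdorff, second countable,
> `C^∞` atlas on `𝓡 4`, `e : M ≃ₕ S⁴`) there are a point `p : M`, a compact Hausdorff second-countable `C^∞`
> 4-manifold with boundary `X` (model `𝓡∂ 4`) admitting a Stein structure (`IsSteinDomain X`) and a smooth
> embedding `f : M ∖ {p} ↪ X` (`Manifold.IsSmoothEmbedding (𝓡 4) (𝓡∂ 4) ∞ f` on the open submanifold `{p}ᶜ`).

This file supersedes the rev-0 skeleton of the same name (written for the retired connected-sum form of the item,
stmt-SmoothPoincare4-18229, whose stub B concluded `IsConnectedSum … X₀ M P`; that conclusion no longer matches the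
route decl).  The LINE is unchanged — **Legendrian surgery on the fake ball** — and so is its load-bearing stub A;
only the topological seam (stub B) is re-cut to land in the embedding form the glue `closes` consumes.

THE LINE.  Remove a coordinate disc from `M`: by the tree THEOREM
`Literature.Topology.FourManifolds.exists_isBoundaryGluing_closedBall` (Milnor 1963 §3; proved, no `sorry`)
`M = 𝔻⁴ ∪_φ W` for a compact 4-manifold with boundary `W` ("the fake ball of `M`": contractible, `∂W ≅ S³`,
`W ≅ 𝔻⁴ ⟺ M ≅ S⁴` by Palais–Cerf), a boundary datum `bW` and a diffeomorphism `φ : S³ ≅ ∂W`.  A Stein host is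
produced the one way compact Stein surfaces are ever produced — as a Legendrian 2-handlebody (Eliashberg 1990 /
Gompf 1998 Thm. 1.3; tree: `IsSteinDomain.isHandlebodyOfIndexLE_two`, `Gompf1998_thm13_twoHandles`): attach
finitely many 2-handles to `∂W` so that `P = W ∪ H² ∪ ⋯ ∪ H²` is a compact Stein domain (STUB A, the bet), and
embed the punctured sphere `M ∖ {centre of the disc} ≅ Int W ⊆ W ∖ ⋃ (attaching circles) ↪ P` (STUB B, collars).

* STUB A `stub_fakeBallTwoHandlesStein` — THE BET, load-bearing and hardest (open-problem sized; verbatim the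
  registered rev-0 stub): for every presentation `M = 𝔻⁴ ∪_φ W` of a homotopy 4-sphere, some simultaneous
  attachment `P` of finitely many 2-handles to `W` (`HandleAttachingMap 3 2 W`,
  `HandleAttachingMap.IsMultiAttachment h (𝓡∂ 4) P`, Kosinski VI §6) is a compact Stein domain
  (`IsSteinDomain P`).  Kirby-calculus form: for some framed link `L ⊂ ∂W ≅ S³`, `W ∪_L 2-handles` admits a
  Legendrian (`tb − 1`) handle presentation.  Known: 0-framed Hopf links reach `♮k (S²×S²)°` (Wall 1964), which is
  NOT Stein (square-zero spheres violate the Lisca–Matić adjunction bound), so the content is exactly to trade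
  Wall's hyperbolic pairs for Legendrian-realisable framings; the cork theorem localises the bet to one
  contractible Akbulut–Matveyev piece.  NOT the crux: it produces no embedding of the punctured sphere and says
  nothing about hosts whose complement has 1- or 3-handles; it yields `HostStein` only through STUB B.  NOT the
  summit: a Stein `P ⊇ W` does not make `W` a ball (no gauge / Stein invariant sees a homotopy-sphere summand,
  `GaugeSumBarrierFour`).  Why it might fail: every 2-handle cobordism on a fake ball might be forced to contain an
  essential sphere violating Stein adjunction — itself a new SPC4-detecting phenomenon.
* STUB B `stub_puncturedIntoAttachment` — classical differential topology, NOT in the tree (size L): if the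
  compact boundaryless 4-manifold `M` is `𝔻⁴ ∪_φ W` and `P` carries a simultaneous attachment of finitely many
  2-handles to `W`, then for some `p : M` the punctured manifold `M ∖ {p}` smoothly embeds in `P`
  (`(𝓡 4) → (𝓡∂ 4)` embedding of the open submanifold `{p}ᶜ`).  Intended witness: `p` = the image of the
  centre of `𝔻⁴`; `M ∖ {p} = W ∪_φ (𝔻⁴ ∖ 0) ≅ W ∪_{∂W} (∂W × [0, 1)) ≅ Int W` (punctured disc = external collar;
  collar theorem `BoundaryData.nonempty_collar` + uniqueness of gluings `nonempty_diffeomorph_of_isBoundaryGluing`),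
  and `Int W ⊆ W ∖ ⋃ᵢ hᵢ(S¹)` (attaching circles lie on `∂W`, `HandleAttachingMap.core_subset_boundary`) is carried
  into `P` by the piece embedding `jA` of `IsMultiAttachment`.  Sources: Hirsch 1976 §4.6 and §8.2; Kosinski 1993
  VI §§1, 6; Milnor 1965 §1.  NOT the crux / summit: no Stein content at all.  Why it might fail as typed: only
  through a mismatch of the relational gluing predicates (`IsBoundaryGluing` / `IsMultiAttachment` collars), not
  mathematically; no hypothesis is vacuous (`M = S⁴`, `W = 𝔻⁴`, `ι = ∅`, `P = W` instantiates everything).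

COMPOSITION (kernel-checked, no `sorry` outside the two stubs):
`HostStein_of : Registered.stub_fakeBallTwoHandlesStein → Registered.stub_puncturedIntoAttachment → SteinHost.HostStein`
— the crux BY NAME: at `(M, e)`, `M` is compact (`compactSpace_of_homotopyEquiv_sphere_four_holds`) and non-empty
(path connected, `pathConnectedSpace_of_homotopyEquiv`), so `exists_isBoundaryGluing_closedBall` gives `(W, bW, φ)`;
STUB A gives the Stein 2-handle attachment `P`; STUB B gives `p` and the embedding `M ∖ {p} ↪ P`; done.  The
`Registered.stub_*` abbreviations are the stub statements keyed by name (same pattern as the registered skeleton of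
the sibling crux `SteinSchoenflies`), and the closing `example : SteinHost.HostStein` wires the two sorried stubs in.

DISPROOF USED: none exists — `ledger crux ls stmt-SmoothPoincare4-19247` lists no `Disproof.lean` (2026-08-17T18:45Z)
and `ledger negatives --problem SmoothPoincare4` lists 0 refuted statements: no `_false_without_` obstruction to
honour, no landed Negative lemma to check the stubs against.  Load-bearing hypotheses honoured: `M ≃ₕ S⁴` enters
only STUB A, rightly — for a general closed `M` the analogue of STUB A (indeed of the crux) is false: `ℂℙ² ∖ pt`,
`ℂℙ²bar ∖ pt`, `S²×S² ∖ pt` contain homologically essential spheres of square `≥ -1`, which the adjunction inequality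
excludes from every Stein surface (Lisca–Matić; Akbulut–Matveyev 1998); the Stein conclusion is produced only by
STUB A, and STUB B is pure topology valid for every closed `M`.

BARRIERS (route header technique_class stein-host / stein-inertness; catalogue `Literature/Barriers/SmoothPoincare4/`):
`OpenAnalogueBarrierFour` — respected: nothing is inferred from the open manifold `M ∖ {p}` alone; it is only the
object EMBEDDED, the recogniser lives in the sibling crux.  `StableBarrierFour` / `OneStabilisationBarrier` — evaded
by design: STUB A must avoid `S²×S²` summands (Wall's stabilisation is the non-Stein baseline).
`HCobordismBarrierFour` / `TopologicalBarrierFour` — not engaged (`P` is h-cobordant rel ∂ to the same handles on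
`𝔻⁴`; Stein-ness is not an h-cobordism invariant — Akbulut–Yasui corks — so STUB A sits outside those classes).
`GaugeSumBarrierFour` — not engaged (no invariant is evaluated); `TwistedSphereBarrierFour`,
`RelativeContractibleBarrierFour` — not engaged here (no recognition step in this crux).
-/

noncomputable section

open scoped Manifold ContDiff Topology ContinuousMap

namespace Summit.SmoothPoincare4.SmoothPoincare4.Cruxes.HostStein.Birth

set_option linter.dupNamespace false
set_option linter.unusedVariables false

open Summit.SmoothPoincare4.SmoothPoincare4.Theses
open Literature.Topology.FourManifolds Literature.Geometry.Symplectic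

/-! ## The two registered stubs (`sorry` lives ONLY here) -/

/-- STUB A (registered) — **the fake ball becomes Stein after attaching 2-handles** (THE BET; open problem).
For every smooth homotopy 4-sphere `M` and every presentation `M = 𝔻⁴ ∪_φ W` (`W` compact with boundary
datum `bW`, `φ : S³ ≅ ∂W`, `IsBoundaryGluing`), there are finitely many 2-handle attaching maps
`h i : T → W` and a compact `C^∞` 4-manifold with boundary `P = W ∪_h (2-handles)`
(`HandleAttachingMap.IsMultiAttachment`) which is a Stein domain.
[Eliashberg1990, Gompf1998 Thm. 1.3, GompfStipsicz1999 §11.2, AkbulutMatveyev1998, Wall1964, LiscaMatic1997, Gompf2013] -/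
theorem stub_fakeBallTwoHandlesStein :
    ∀ (M : Type) [TopologicalSpace M] [T2Space M] [SecondCountableTopology M]
      [ChartedSpace (EuclideanSpace ℝ (Fin 4)) M] [IsManifold (𝓡 4) ∞ M],
      M ≃ₕ Metric.sphere (0 : EuclideanSpace ℝ (Fin 5)) 1 →
    ∀ (W : Type) [TopologicalSpace W] [T2Space W] [SecondCountableTopology W]
      [ChartedSpace (EuclideanHalfSpace 4) W] [IsManifold (𝓡∂ 4) ∞ W] [CompactSpace W]
      (bW : BoundaryData (𝓡∂ 4) W (𝓡 3)) (φ : ((closedBallBoundaryData 3).ulift :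
          BoundaryData (𝓡∂ 4) (ULift.{0} (Metric.closedBall (0 : EuclideanSpace ℝ (Fin 4)) 1)) (𝓡 3)).carrier
          ≃ₘ⟮𝓡 3, 𝓡 3⟯ bW.carrier),
      IsBoundaryGluing
        ((closedBallBoundaryData 3).ulift :
          BoundaryData (𝓡∂ 4) (ULift.{0} (Metric.closedBall (0 : EuclideanSpace ℝ (Fin 4)) 1)) (𝓡 3))
        bW φ (𝓡 4) M →
    ∃ (ι : Type) (_ : Finite ι) (h : ι → HandleAttachingMap 3 2 W)
      (P : Type) (_ : TopologicalSpace P) (_ : T2Space P) (_ : SecondCountableTopology P)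
      (_ : ChartedSpace (EuclideanHalfSpace 4) P) (_ : IsManifold (𝓡∂ 4) ∞ P) (_ : CompactSpace P),
      HandleAttachingMap.IsMultiAttachment h (𝓡∂ 4) P ∧ IsSteinDomain P := by
  sorry

/-- STUB B (registered) — **the punctured manifold embeds in any handle attachment on the ball complement**
(classical differential topology, not in the tree).  If the compact boundaryless 4-manifold `M` is `𝔻⁴ ∪_φ W` and `P`
is `W` with finitely many 2-handles attached simultaneously, then for some point `p : M` (the centre of the disc)
the punctured manifold `M ∖ {p}` — the open submanifold `{p}ᶜ` of `M` — smoothly embeds in `P`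
(`M ∖ {p} ≅ Int W ⊆ W ∖ ⋃ᵢ hᵢ(S¹) ↪ P`: punctured disc = external collar of `∂W`, collar theorem, uniqueness of
boundary gluings, and the piece embedding of the attachment).
[Hirsch1976 §4.6 and §8.2, Kosinski1993 VI §§1 and 6, MilnorHCobordism1965 §1] -/
theorem stub_puncturedIntoAttachment :
    ∀ (M : Type) [TopologicalSpace M] [T2Space M] [SecondCountableTopology M]
      [ChartedSpace (EuclideanSpace ℝ (Fin 4)) M] [IsManifold (𝓡 4) ∞ M] [CompactSpace M]
      (W : Type) [TopologicalSpace W] [T2Space W] [SecondCountableTopology W]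
      [ChartedSpace (EuclideanHalfSpace 4) W] [IsManifold (𝓡∂ 4) ∞ W] [CompactSpace W]
      (bW : BoundaryData (𝓡∂ 4) W (𝓡 3)) (φ : ((closedBallBoundaryData 3).ulift :
          BoundaryData (𝓡∂ 4) (ULift.{0} (Metric.closedBall (0 : EuclideanSpace ℝ (Fin 4)) 1)) (𝓡 3)).carrier
          ≃ₘ⟮𝓡 3, 𝓡 3⟯ bW.carrier),
      IsBoundaryGluing
        ((closedBallBoundaryData 3).ulift :
          BoundaryData (𝓡∂ 4) (ULift.{0} (Metric.closedBall (0 : EuclideanSpace ℝ (Fin 4)) 1)) (𝓡 3))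
        bW φ (𝓡 4) M →
    ∀ (ι : Type) [Finite ι] (h : ι → HandleAttachingMap 3 2 W)
      (P : Type) [TopologicalSpace P] [T2Space P] [SecondCountableTopology P]
      [ChartedSpace (EuclideanHalfSpace 4) P] [IsManifold (𝓡∂ 4) ∞ P],
      HandleAttachingMap.IsMultiAttachment h (𝓡∂ 4) P →
    ∃ (p : M) (f : (⟨{p}ᶜ, isOpen_compl_singleton⟩ : TopologicalSpace.Opens M) → P),
      Manifold.IsSmoothEmbedding (𝓡 4) (𝓡∂ 4) ∞ f := by
  sorry

/-! ## Name-keyed aliases of the two stub statements (hypotheses of the composition) -/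
namespace Registered

/-- Alias: the signature of `stub_fakeBallTwoHandlesStein`. -/
abbrev stub_fakeBallTwoHandlesStein : Prop :=
    ∀ (M : Type) [TopologicalSpace M] [T2Space M] [SecondCountableTopology M]
      [ChartedSpace (EuclideanSpace ℝ (Fin 4)) M] [IsManifold (𝓡 4) ∞ M],
      M ≃ₕ Metric.sphere (0 : EuclideanSpace ℝ (Fin 5)) 1 →
    ∀ (W : Type) [TopologicalSpace W] [T2Space W] [SecondCountableTopology W]
      [ChartedSpace (EuclideanHalfSpace 4) W] [IsManifold (𝓡∂ 4) ∞ W] [CompactSpace W]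
      (bW : BoundaryData (𝓡∂ 4) W (𝓡 3)) (φ : ((closedBallBoundaryData 3).ulift :
          BoundaryData (𝓡∂ 4) (ULift.{0} (Metric.closedBall (0 : EuclideanSpace ℝ (Fin 4)) 1)) (𝓡 3)).carrier
          ≃ₘ⟮𝓡 3, 𝓡 3⟯ bW.carrier),
      IsBoundaryGluing
        ((closedBallBoundaryData 3).ulift :
          BoundaryData (𝓡∂ 4) (ULift.{0} (Metric.closedBall (0 : EuclideanSpace ℝ (Fin 4)) 1)) (𝓡 3))
        bW φ (𝓡 4) M →
    ∃ (ι : Type) (_ : Finite ι) (h : ι → HandleAttachingMap 3 2 W)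
      (P : Type) (_ : TopologicalSpace P) (_ : T2Space P) (_ : SecondCountableTopology P)
      (_ : ChartedSpace (EuclideanHalfSpace 4) P) (_ : IsManifold (𝓡∂ 4) ∞ P) (_ : CompactSpace P),
      HandleAttachingMap.IsMultiAttachment h (𝓡∂ 4) P ∧ IsSteinDomain P

/-- Alias: the signature of `stub_puncturedIntoAttachment`. -/
abbrev stub_puncturedIntoAttachment : Prop :=
    ∀ (M : Type) [TopologicalSpace M] [T2Space M] [SecondCountableTopology M]
      [ChartedSpace (EuclideanSpace ℝ (Fin 4)) M] [IsManifold (𝓡 4) ∞ M] [CompactSpace M]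
      (W : Type) [TopologicalSpace W] [T2Space W] [SecondCountableTopology W]
      [ChartedSpace (EuclideanHalfSpace 4) W] [IsManifold (𝓡∂ 4) ∞ W] [CompactSpace W]
      (bW : BoundaryData (𝓡∂ 4) W (𝓡 3)) (φ : ((closedBallBoundaryData 3).ulift :
          BoundaryData (𝓡∂ 4) (ULift.{0} (Metric.closedBall (0 : EuclideanSpace ℝ (Fin 4)) 1)) (𝓡 3)).carrier
          ≃ₘ⟮𝓡 3, 𝓡 3⟯ bW.carrier),
      IsBoundaryGluing
        ((closedBallBoundaryData 3).ulift :
          BoundaryData (𝓡∂ 4) (ULift.{0} (Metric.closedBall (0 : EuclideanSpace ℝ (Fin 4)) 1)) (𝓡 3))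
        bW φ (𝓡 4) M →
    ∀ (ι : Type) [Finite ι] (h : ι → HandleAttachingMap 3 2 W)
      (P : Type) [TopologicalSpace P] [T2Space P] [SecondCountableTopology P]
      [ChartedSpace (EuclideanHalfSpace 4) P] [IsManifold (𝓡∂ 4) ∞ P],
      HandleAttachingMap.IsMultiAttachment h (𝓡∂ 4) P →
    ∃ (p : M) (f : (⟨{p}ᶜ, isOpen_compl_singleton⟩ : TopologicalSpace.Opens M) → P),
      Manifold.IsSmoothEmbedding (𝓡 4) (𝓡∂ 4) ∞ f

end Registered

/-! ## Composition: stubs ⟹ crux (kernel-checked, no `sorry` below this line) -/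

/-- **`HostStein_of` — THE SKELETON**: `stub_A-sig → stub_B-sig → SteinHost.HostStein`, the crux BY NAME, sorry-free.
Given the binders `(M, e : M ≃ₕ S⁴)` of `HostStein`: `M` is compact (`compactSpace_of_homotopyEquiv_sphere_four_holds`)
and non-empty (path connected), so `exists_isBoundaryGluing_closedBall` presents `M = 𝔻⁴ ∪_φ W`; STUB A gives a compact
Stein 2-handle attachment `P ⊇ W`; STUB B gives `p : M` and the smooth embedding `M ∖ {p} ↪ P`; `(p, P, _, f)` is
the witness. [cite: Milnor1963, §3] [cite: Gompf1998, Thm. 1.3] -/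
theorem HostStein_of :
    Registered.stub_fakeBallTwoHandlesStein → Registered.stub_puncturedIntoAttachment → SteinHost.HostStein := by
  intro hA hB M _ _ _ _ _ e
  haveI : CompactSpace M := compactSpace_of_homotopyEquiv_sphere_four_holds M e
  haveI : PathConnectedSpace (Metric.sphere (0 : EuclideanSpace ℝ (Fin 5)) 1) :=
    pathConnectedSpace_sphere_four
  haveI : PathConnectedSpace M := pathConnectedSpace_of_homotopyEquiv e
  -- `M = 𝔻⁴ ∪_φ W`: the fake ball `W` of `M` (tree theorem, Milnor 1963 §3)
  obtain ⟨W, _, _, _, _, _, bW, φ, hWc, hMW⟩ :=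
    exists_isBoundaryGluing_closedBall (k := 3) (by norm_num) M
  haveI : CompactSpace W := hWc
  -- STUB A: a compact Stein 2-handle attachment `P = W ∪ 2-handles`
  obtain ⟨ι, _, h, P, _, _, _, _, _, _, hP, hSt⟩ := hA M e W bW φ hMW
  -- STUB B: the punctured sphere embeds in `P`
  obtain ⟨p, f, hf⟩ := hB M W bW φ hMW ι h P hP
  exact ⟨p, P, inferInstance, inferInstance, inferInstance, inferInstance, inferInstance, inferInstance,
    hSt, f, hf⟩

/-- Wiring check: the two registered stubs feed `HostStein_of` exactly as stated (aliases = signatures), so the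
skeleton is `SteinHost.HostStein` closed modulo the stubs; `sorry` enters only through `stub_*`. -/
example : SteinHost.HostStein :=
  HostStein_of stub_fakeBallTwoHandlesStein stub_puncturedIntoAttachment

end Summit.SmoothPoincare4.SmoothPoincare4.Cruxes.HostStein.Birth

end
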